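import Summits.HubbardSuperconductivity.HubbardSuperconductivity.Theses.KkFloor
import Summits.HubbardSuperconductivity.HubbardSuperconductivity.Theorems.KkFloorKkFloorTheorem
import Summits.HubbardSuperconductivity.HubbardSuperconductivity.Theorems.KkFloorLiftToSummit

/-!
# Route `KkFloor` — assembly item `Assembly` (stmt-HubbardSuperconductivity-10411)

`KkFloor.Assembly` (Theses/KkFloor.lean rev 1) is the curried implication
`KkFloorTheorem → KkBandLift → KkLiftToSummit → HubbardSuperconductivity`
from the route's items to the summit statement `HubbardSuperconductivity`. It is, binder for binder, the type of the route file's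
DECIDING THEOREM `KkFloor.closes` (planner-authored glue, elaborated with the route file and certified
by `#h21_check_closes`): the items are exactly its hypotheses and its conclusion is the
sub-problem statement. This file closed the assembly item BY NAME with that glue — the theorem
had type literally `Summit.HubbardSuperconductivity.HubbardSuperconductivity.Theses.KkFloor.Assembly` and its proof term is `KkFloor.closes`. Pure logic over the
route's own declarations: no analysis, no new definitions, no restatement of any item.

Source for the order parameter / summit matrix being assembled: D. J. Scalapino, Phys. Rep. 250
(1995) 329, §2.

**Repair 2026-08-17 (fullbuild breakage "32:2: Type mismatch").** The route repair of
2026-08-16T10:08Z (rev 4) restated `Assembly` UNDER THE SAME DECL NAME as the frame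
`KkBandLift → HubbardSuperconductivity` (item stmt-HubbardSuperconductivity-15170, OPEN: modulo the proved
`KkLiftToSummit` it is the open crux `KkFloorTheorem`, stmt-10406, applied), while `closes` kept its
three hypotheses; so the proof term `KkFloor.closes` stopped fitting the re-typed statement, which is not
provable by bookkeeping. Theorems files are append-only (a recorded declaration is neither restated nor
removed), so the repair DEPRECATES: the chain the theorem proved — the rev-1 `Assembly`, ledger signature
of stmt-10411 verbatim, i.e. the type of `closes` — is written out arrow for arrow as
`kkFloor_closes_chain := KkFloor.closes`, and the old name `kkFloor_assembly_proof` (closing decl of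
record of stmt-10411) is kept as a `@[deprecated]` alias of it. Neither proves the live item stmt-15170
(recipe once stmt-10406 lands: `fun b => KkFloor.closes ‹KkFloorTheorem› b kkLiftToSummit_proof`), and
neither serves a `_holds` link.  2026-08-17: `KkFloorTheorem` landed (`kkFloorTheorem_proof`), and the live
item stmt-15170 is closed below by `kkFloorAssembly_proof` (that recipe).
-/

-- the mandated namespace `Summit.<Summit>.<Problem>.Theorems` repeats `HubbardSuperconductivity`
-- (single-problem summit, D-0017), which the `dupNamespace` linter flags on every declaration
set_option linter.dupNamespace false

namespace Summit.HubbardSuperconductivity.HubbardSuperconductivity.Theorems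

/-- **The `closes` chain of route `KkFloor`, written out** (the rev-1 assembly item
`stmt-HubbardSuperconductivity-10411`, ledger signature verbatim):
`KkFloorTheorem → KkBandLift → KkLiftToSummit → HubbardSuperconductivity`.
The route's deciding theorem `KkFloor.closes` takes the items as named hypotheses and concludes the
sub-problem statement; read as a closed implication it is exactly this chain. [folklore] -/
theorem kkFloor_closes_chain :
    Summit.HubbardSuperconductivity.HubbardSuperconductivity.Theses.KkFloor.KkFloorTheorem →
      Summit.HubbardSuperconductivity.HubbardSuperconductivity.Theses.KkFloor.KkBandLift →
        Summit.HubbardSuperconductivity.HubbardSuperconductivity.Theses.KkFloor.KkLiftToSummit →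
          HubbardSuperconductivity :=
  Summit.HubbardSuperconductivity.HubbardSuperconductivity.Theses.KkFloor.closes

/-- **Deprecated record** of the closing theorem of stmt-HubbardSuperconductivity-10411 (formerly
`theorem kkFloor_assembly_proof : KkFloor.Assembly := KkFloor.closes`): the route decl `Assembly` was
restated under the same name (rev 4, stmt-15170, the OPEN frame `KkBandLift → HubbardSuperconductivity`),
so the name is kept as an alias of the written-out chain it proved (`kkFloor_closes_chain`). [folklore] -/
@[deprecated kkFloor_closes_chain (since := "2026-08-17")]
alias kkFloor_assembly_proof := kkFloor_closes_chain

/-- **`KkFloor.Assembly` (rev 4) holds** — item stmt-HubbardSuperconductivity-15170, the live frame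
`KkBandLift → HubbardSuperconductivity`: the proved supports `KkFloorTheorem` (stmt-10406,
`kkFloorTheorem_proof`, landed 2026-08-17) and `KkLiftToSummit` (stmt-10410, `kkLiftToSummit_proof`)
leave `KkBandLift` as the only hypothesis; the proof is the planner's one-liner
`fun b => kkLiftToSummit_proof kkFloorTheorem_proof b` (equivalently `KkFloor.closes kkFloorTheorem_proof b
kkLiftToSummit_proof`). Pure bookkeeping; the open mathematics is the crux `KkBandLift`. [folklore] -/
theorem kkFloorAssembly_proof :
    Summit.HubbardSuperconductivity.HubbardSuperconductivity.Theses.KkFloor.Assembly :=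
  fun b => kkLiftToSummit_proof kkFloorTheorem_proof b

end Summit.HubbardSuperconductivity.HubbardSuperconductivity.Theorems
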